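import Summits.CriticalPhenomena.SAWScalingLimit.Theses.SAWPoissonHoneycomb

/-!
# Line `subseq-identification` for the crux `DensityUniversality` (stmt-CriticalPhenomena-6936)

Registered skeleton (crux-strategist, 2026-08-17), REFINING the line `bulk_collar`: each of the two
split children `DUBulk` / `DUCollar` is cut by the classical "precompactness + identification of
joint subsequential limits" architecture, so that provers get three named stubs of genuinely
different nature:

* `stub_admPrecompact` — SEQUENTIAL WEAK PRECOMPACTNESS of the annealed laws `Q ρ D (t n)` along
  every sequence `t n → 0+`, for every admissible density (a-priori tightness + mass bound +
  Prokhorov on `CurveClass ℂ`; the a-priori half of the problem, shared by both children);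
* `stub_bulkLimitUnique` — IDENTIFICATION (bulk): along one sequence `t n → 0+`, a weak limit `P`
  of `Q_ρ` (ρ bulk-class: `C²` on `ℂ`, `tsupport (ρ - 1) ⊆ D`) and a weak limit `P'` of `Q_1`
  integrate every bounded continuous `f` equally — the Harris/Weyl-invariance heart, now a
  statement about LIMIT OBJECTS (where restriction, covariance and LSW-type characterisations
  live) instead of about finite `δ`;
* `stub_collarLimitStable` — IDENTIFICATION (collar): `∀ η ∃ ε`, joint subsequential limits of
  `Q_ρ` and `Q_{ρ'}` (ρ' admissible, `= ρ` on `{dist(·, Dᶜ) ≥ ε}`) differ by `< η` on the given `f`.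

Composition (kernel-checked, sorries = the three stubs): `duBulk_of` (subsequence-of-subsequence
criterion `Filter.tendsto_of_subseq_tendsto` + two extractions + uniqueness), `duCollar_of`
(by contradiction: `Filter.exists_seq_forall_of_frequently` + two extractions + `ge_of_tendsto'`),
then the bulk/collar glue of `Lines/bulk_collar.lean` (smooth Urysohn collar cutoff + η/2),
repeated here so that the file is self-contained. Each stub is a CONSEQUENCE of the corresponding
child (limits of asymptotically equal sequences agree), hence of the crux; none is the crux.
-/

namespace Summit.CriticalPhenomena.SAWScalingLimit.Cruxes.DensityUniversality.SubseqIdentification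

open scoped Topology
open Set Filter

/-- **Stub 1 (sequential weak precompactness of the annealed laws, every admissible density).**
Along every sequence `t n → 0+` some subsequence of `Q ρ D (t n)` converges weakly (against bounded
continuous test functions) to a finite measure on `CurveClass ℂ`. A-priori tightness (annulus-crossing
bounds for the critical annealed walk, robust to the density) + Prokhorov. Open, size L. -/
theorem stub_admPrecompact :
    ∀ (Pois : MeasureTheory.Measure ℂ → MeasureTheory.Measure (Literature.Analysis.FunctionSpaces.PointConfig ℂ)), (∀ ν : MeasureTheory.Measure ℂ, MeasureTheory.IsLocallyFiniteMeasure ν → (∀ z : ℂ, ν {z} = 0) → Literature.Analysis.FunctionSpaces.IsPoissonPointProcess ν (Pois ν)) → let S : Literature.Analysis.FunctionSpaces.PointConfig ℂ → ℂ → Set ℂ := fun ω c => (ω : Set ℂ) ∩ Metric.sphere c (Metric.infDist c (ω : Set ℂ)); let vor : Literature.Analysis.FunctionSpaces.PointConfig ℂ → SimpleGraph ℂ := fun ω => SimpleGraph.fromRel fun c c' => 3 ≤ (S ω c).encard ∧ 3 ≤ (S ω c').encard ∧ (S ω c ∩ S ω c').encard = 2; let μ : ENNReal := essSup (fun ω =>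 Filter.limsup (fun n : ℕ => (⨆ c : Metric.closedBall (0 : ℂ) 1, (Literature.Probability.RandomPlanarGeometry.SAW.sawCount (vor ω) (c : ℂ) n : ENNReal)) ^ (1 / (n : ℝ))) Filter.atTop) (Pois MeasureTheory.volume); let xc : ℝ := (μ.toReal)⁻¹; let near : Literature.Analysis.FunctionSpaces.PointConfig ℂ → Set ℂ → ℂ → ℂ := fun ω Ω z => Classical.epsilon fun v : ℂ => v ∈ Literature.Probability.RandomPlanarGeometry.SAW.embMeshDomain (vor ω) id Ω 1 ∧ ∀ w ∈ Literature.Probability.RandomPlanarGeometry.SAW.embMeshDomain (vor ω) id Ω 1, dist v z ≤ dist w z; let intens : (ℂ → ℝ) → ℝ → MeasureTheory.Measure ℂ := fun ρ δ => ENNReal.ofReal (δ⁻¹ ^ 2) • MeasureTheory.volume.withDensity fun z => ENNReal.ofReal (ρ z); let qlaw : Literature.Probability.RandomPlanarGeometry.DobrushinDomain → Literature.Analysis.FunctionSpaces.PointConfig ℂ → MeasureTheory.Measure (Literature.Probability.RandomPlanarGeometry.CurveClass ℂ) := fun D ω => (Literature.Probability.RandomPlanarGeometry.SAW.embLaw (vor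 ω) id D.carrier 1 xc (near ω D.carrier (D.pt 0)) (near ω D.carrier (D.pt 1))).map fun γ => γ.curve; let Q : (ℂ → ℝ) → Literature.Probability.RandomPlanarGeometry.DobrushinDomain → ℝ → MeasureTheory.Measure (Literature.Probability.RandomPlanarGeometry.CurveClass ℂ) := fun ρ D δ => (Pois (intens ρ δ)).bind (qlaw D); ∀ (D : Literature.Probability.RandomPlanarGeometry.DobrushinDomain) (ρ : ℂ → ℝ), ContDiffOn ℝ 2 ρ D.carrier → (∀ z ∈ D.carrier, 0 < ρ z) → (∀ z ∉ D.carrier, ρ z = 1) → MeasureTheory.IntegrableOn ρ D.carrier → ∀ t : ℕ → ℝ, Filter.Tendsto t Filter.atTop (nhdsWithin 0 (Set.Ioi 0)) → ∃ φ : ℕ → ℕ, StrictMono φ ∧ ∃ P : MeasureTheory.Measure (Literature.Probability.RandomPlanarGeometry.CurveClass ℂ), MeasureTheory.IsFiniteMeasure P ∧ ∀ f : BoundedContinuousFunction (Literature.Probability.RandomPlanarGeometry.CurveClass ℂ) ℝ, Filter.Tendsto (fun n => ∫ x, f x ∂(Q ρ D (t (φ n)))) Filter.atTop (nhds (∫ x,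 f x ∂P)) := by
  sorry

/-- **Stub 2 (identification of joint subsequential limits, bulk densities).** For a bulk-class
density `ρ` (`C²` on `ℂ`, `tsupport (ρ - 1) ⊆ D`) and one sequence `t n → 0+` along which `Q_ρ ⇀ P`
and `Q_1 ⇀ P'`, the limits agree on every bounded continuous `f`. The Harris / Weyl-invariance heart
of DensityUniversality, as a statement about limit objects. Open, size XL. -/
theorem stub_bulkLimitUnique :
    ∀ (Pois : MeasureTheory.Measure ℂ → MeasureTheory.Measure (Literature.Analysis.FunctionSpaces.PointConfig ℂ)), (∀ ν : MeasureTheory.Measure ℂ, MeasureTheory.IsLocallyFiniteMeasure ν → (∀ z : ℂ, ν {z} = 0) → Literature.Analysis.FunctionSpaces.IsPoissonPointProcess ν (Pois ν)) → let S : Literature.Analysis.FunctionSpaces.PointConfig ℂ → ℂ → Set ℂ := fun ω c => (ω : Set ℂ) ∩ Metric.sphere c (Metric.infDist c (ω : Set ℂ)); let vor : Literature.Analysis.FunctionSpaces.PointConfig ℂ → SimpleGraph ℂ := fun ω => SimpleGraph.fromRel fun c c' => 3 ≤ (S ω c).encard ∧ 3 ≤ (S ω c').encard ∧ (S ω c ∩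 S ω c').encard = 2; let μ : ENNReal := essSup (fun ω => Filter.limsup (fun n : ℕ => (⨆ c : Metric.closedBall (0 : ℂ) 1, (Literature.Probability.RandomPlanarGeometry.SAW.sawCount (vor ω) (c : ℂ) n : ENNReal)) ^ (1 / (n : ℝ))) Filter.atTop) (Pois MeasureTheory.volume); let xc : ℝ := (μ.toReal)⁻¹; let near : Literature.Analysis.FunctionSpaces.PointConfig ℂ → Set ℂ → ℂ → ℂ := fun ω Ω z => Classical.epsilon fun v : ℂ => v ∈ Literature.Probability.RandomPlanarGeometry.SAW.embMeshDomain (vor ω) id Ω 1 ∧ ∀ w ∈ Literature.Probability.RandomPlanarGeometry.SAW.embMeshDomain (vor ω) id Ω 1, dist v z ≤ dist w z; let intens : (ℂ → ℝ) → ℝ → MeasureTheory.Measure ℂ := fun ρ δ => ENNReal.ofReal (δ⁻¹ ^ 2) • MeasureTheory.volume.withDensity fun z => ENNReal.ofReal (ρ z); let qlaw : Literature.Probability.RandomPlanarGeometry.DobrushinDomain → Literature.Analysis.FunctionSpaces.PointConfig ℂ → MeasureTheory.Measure (Literature.Probability.RandomPlanarGeometry.CurveClass ℂ) := fun D ω =>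 (Literature.Probability.RandomPlanarGeometry.SAW.embLaw (vor ω) id D.carrier 1 xc (near ω D.carrier (D.pt 0)) (near ω D.carrier (D.pt 1))).map fun γ => γ.curve; let Q : (ℂ → ℝ) → Literature.Probability.RandomPlanarGeometry.DobrushinDomain → ℝ → MeasureTheory.Measure (Literature.Probability.RandomPlanarGeometry.CurveClass ℂ) := fun ρ D δ => (Pois (intens ρ δ)).bind (qlaw D); ∀ (D : Literature.Probability.RandomPlanarGeometry.DobrushinDomain) (ρ : ℂ → ℝ), ContDiffOn ℝ 2 ρ D.carrier → (∀ z ∈ D.carrier, 0 < ρ z) → (∀ z ∉ D.carrier, ρ z = 1) → MeasureTheory.IntegrableOn ρ D.carrier → ContDiff ℝ 2 ρ → tsupport (fun z => ρ z - 1) ⊆ D.carrier → ∀ t : ℕ → ℝ, Filter.Tendsto t Filter.atTop (nhdsWithin 0 (Set.Ioi 0)) → ∀ P P' : MeasureTheory.Measure (Literature.Probability.RandomPlanarGeometry.CurveClass ℂ), (∀ f : BoundedContinuousFunction (Literature.Probability.RandomPlanarGeometry.CurveClass ℂ) ℝ, Filter.Tendsto (fun n => ∫ x, f x ∂(Q ρ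 D (t n))) Filter.atTop (nhds (∫ x, f x ∂P))) → (∀ f : BoundedContinuousFunction (Literature.Probability.RandomPlanarGeometry.CurveClass ℂ) ℝ, Filter.Tendsto (fun n => ∫ x, f x ∂(Q (fun _ => 1) D (t n))) Filter.atTop (nhds (∫ x, f x ∂P'))) → ∀ f : BoundedContinuousFunction (Literature.Probability.RandomPlanarGeometry.CurveClass ℂ) ℝ, ∫ x, f x ∂P = ∫ x, f x ∂P' := by
  sorry

/-- **Stub 3 (collar stability of joint subsequential limits).** `∀ η > 0 ∃ ε > 0`: for admissible
`ρ'` agreeing with `ρ` on `{z ∈ D | ε ≤ dist(z, Dᶜ)}` and one sequence `t n → 0+` along which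
`Q_ρ ⇀ P`, `Q_{ρ'} ⇀ P'`: `|∫ f dP − ∫ f dP'| < η`. Tip universality + uniform no-return to `∂D`,
read on limit objects. Open, size XL. -/
theorem stub_collarLimitStable :
    ∀ (Pois : MeasureTheory.Measure ℂ → MeasureTheory.Measure (Literature.Analysis.FunctionSpaces.PointConfig ℂ)), (∀ ν : MeasureTheory.Measure ℂ, MeasureTheory.IsLocallyFiniteMeasure ν → (∀ z : ℂ, ν {z} = 0) → Literature.Analysis.FunctionSpaces.IsPoissonPointProcess ν (Pois ν)) → let S : Literature.Analysis.FunctionSpaces.PointConfig ℂ → ℂ → Set ℂ := fun ω c => (ω : Set ℂ) ∩ Metric.sphere c (Metric.infDist c (ω : Set ℂ)); let vor : Literature.Analysis.FunctionSpaces.PointConfig ℂ → SimpleGraph ℂ := fun ω => SimpleGraph.fromRel fun c c' => 3 ≤ (S ω c).encard ∧ 3 ≤ (S ω c').encard ∧ (S ω c ∩ S ω c').encard = 2; let μ : ENNReal := essSup (fun ω => Filter.limsup (fun n : ℕ => (⨆ c : Metric.closedBall (0 : ℂ) 1, (Literature.Probability.RandomPlanarGeometry.SAW.sawCount (vor ω)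 (c : ℂ) n : ENNReal)) ^ (1 / (n : ℝ))) Filter.atTop) (Pois MeasureTheory.volume); let xc : ℝ := (μ.toReal)⁻¹; let near : Literature.Analysis.FunctionSpaces.PointConfig ℂ → Set ℂ → ℂ → ℂ := fun ω Ω z => Classical.epsilon fun v : ℂ => v ∈ Literature.Probability.RandomPlanarGeometry.SAW.embMeshDomain (vor ω) id Ω 1 ∧ ∀ w ∈ Literature.Probability.RandomPlanarGeometry.SAW.embMeshDomain (vor ω) id Ω 1, dist v z ≤ dist w z; let intens : (ℂ → ℝ) → ℝ → MeasureTheory.Measure ℂ := fun ρ δ => ENNReal.ofReal (δ⁻¹ ^ 2) • MeasureTheory.volume.withDensity fun z => ENNReal.ofReal (ρ z); let qlaw : Literature.Probability.RandomPlanarGeometry.DobrushinDomain → Literature.Analysis.FunctionSpaces.PointConfig ℂ → MeasureTheory.Measure (Literature.Probability.RandomPlanarGeometry.CurveClass ℂ) := fun D ω => (Literature.Probability.RandomPlanarGeometry.SAW.embLaw (vor ω) id D.carrier 1 xc (near ω D.carrier (D.pt 0)) (near ω D.carrier (D.pt 1))).map fun γ => γ.curve; let Q : (ℂ → ℝ)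 → Literature.Probability.RandomPlanarGeometry.DobrushinDomain → ℝ → MeasureTheory.Measure (Literature.Probability.RandomPlanarGeometry.CurveClass ℂ) := fun ρ D δ => (Pois (intens ρ δ)).bind (qlaw D); ∀ (D : Literature.Probability.RandomPlanarGeometry.DobrushinDomain) (ρ : ℂ → ℝ), ContDiffOn ℝ 2 ρ D.carrier → (∀ z ∈ D.carrier, 0 < ρ z) → (∀ z ∉ D.carrier, ρ z = 1) → MeasureTheory.IntegrableOn ρ D.carrier → ∀ (f : BoundedContinuousFunction (Literature.Probability.RandomPlanarGeometry.CurveClass ℂ) ℝ) (η : ℝ), 0 < η → ∃ ε : ℝ, 0 < ε ∧ ∀ ρ' : ℂ → ℝ, ContDiffOn ℝ 2 ρ' D.carrier → (∀ z ∈ D.carrier, 0 < ρ' z) → (∀ z ∉ D.carrier, ρ' z = 1) → MeasureTheory.IntegrableOn ρ' D.carrier → Set.EqOn ρ' ρ {z | z ∈ D.carrier ∧ ε ≤ Metric.infDist z D.carrierᶜ} → ∀ t : ℕ → ℝ, Filter.Tendsto t Filter.atTop (nhdsWithin 0 (Set.Ioi 0)) → ∀ P P' : MeasureTheory.Measure (Literature.Probability.RandomPlanarGeometry.CurveClass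 ℂ), (∀ g : BoundedContinuousFunction (Literature.Probability.RandomPlanarGeometry.CurveClass ℂ) ℝ, Filter.Tendsto (fun n => ∫ x, g x ∂(Q ρ D (t n))) Filter.atTop (nhds (∫ x, g x ∂P))) → (∀ g : BoundedContinuousFunction (Literature.Probability.RandomPlanarGeometry.CurveClass ℂ) ℝ, Filter.Tendsto (fun n => ∫ x, g x ∂(Q ρ' D (t n))) Filter.atTop (nhds (∫ x, g x ∂P'))) → |(∫ x, f x ∂P) - ∫ x, f x ∂P'| < η := by
  sorry

/-! ### Name-keyed aliases of the stub statements (device of `Lines/birth.lean`) -/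

/-- The statement of `stub_admPrecompact`, as a `Prop`. -/
def AdmPrecompactStmt : Prop :=
  ∀ (Pois : MeasureTheory.Measure ℂ → MeasureTheory.Measure (Literature.Analysis.FunctionSpaces.PointConfig ℂ)), (∀ ν : MeasureTheory.Measure ℂ, MeasureTheory.IsLocallyFiniteMeasure ν → (∀ z : ℂ, ν {z} = 0) → Literature.Analysis.FunctionSpaces.IsPoissonPointProcess ν (Pois ν)) → let S : Literature.Analysis.FunctionSpaces.PointConfig ℂ → ℂ → Set ℂ := fun ω c => (ω : Set ℂ) ∩ Metric.sphere c (Metric.infDist c (ω : Set ℂ)); let vor : Literature.Analysis.FunctionSpaces.PointConfig ℂ → SimpleGraph ℂ := fun ω => SimpleGraph.fromRel fun c c' => 3 ≤ (S ω c).encard ∧ 3 ≤ (S ω c').encard ∧ (S ω c ∩ S ω c').encard = 2; let μ : ENNReal := essSup (fun ω => Filter.limsup (fun n : ℕ => (⨆ c : Metric.closedBall (0 : ℂ) 1, (Literature.Probability.RandomPlanarGeometry.SAW.sawCount (vor ω) (c : ℂ) n : ENNReal)) ^ (1 / (n : ℝ))) Filter.atTop) (Pois MeasureTheory.volume); let xc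 : ℝ := (μ.toReal)⁻¹; let near : Literature.Analysis.FunctionSpaces.PointConfig ℂ → Set ℂ → ℂ → ℂ := fun ω Ω z => Classical.epsilon fun v : ℂ => v ∈ Literature.Probability.RandomPlanarGeometry.SAW.embMeshDomain (vor ω) id Ω 1 ∧ ∀ w ∈ Literature.Probability.RandomPlanarGeometry.SAW.embMeshDomain (vor ω) id Ω 1, dist v z ≤ dist w z; let intens : (ℂ → ℝ) → ℝ → MeasureTheory.Measure ℂ := fun ρ δ => ENNReal.ofReal (δ⁻¹ ^ 2) • MeasureTheory.volume.withDensity fun z => ENNReal.ofReal (ρ z); let qlaw : Literature.Probability.RandomPlanarGeometry.DobrushinDomain → Literature.Analysis.FunctionSpaces.PointConfig ℂ → MeasureTheory.Measure (Literature.Probability.RandomPlanarGeometry.CurveClass ℂ) := fun D ω => (Literature.Probability.RandomPlanarGeometry.SAW.embLaw (vor ω) id D.carrier 1 xc (near ω D.carrier (D.pt 0)) (near ω D.carrier (D.pt 1))).map fun γ => γ.curve; let Q : (ℂ → ℝ) → Literature.Probability.RandomPlanarGeometry.DobrushinDomain → ℝ → MeasureTheory.Measure (Literature.Probability.RandomPlanarGeometry.CurveClass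 ℂ) := fun ρ D δ => (Pois (intens ρ δ)).bind (qlaw D); ∀ (D : Literature.Probability.RandomPlanarGeometry.DobrushinDomain) (ρ : ℂ → ℝ), ContDiffOn ℝ 2 ρ D.carrier → (∀ z ∈ D.carrier, 0 < ρ z) → (∀ z ∉ D.carrier, ρ z = 1) → MeasureTheory.IntegrableOn ρ D.carrier → ∀ t : ℕ → ℝ, Filter.Tendsto t Filter.atTop (nhdsWithin 0 (Set.Ioi 0)) → ∃ φ : ℕ → ℕ, StrictMono φ ∧ ∃ P : MeasureTheory.Measure (Literature.Probability.RandomPlanarGeometry.CurveClass ℂ), MeasureTheory.IsFiniteMeasure P ∧ ∀ f : BoundedContinuousFunction (Literature.Probability.RandomPlanarGeometry.CurveClass ℂ) ℝ, Filter.Tendsto (fun n => ∫ x, f x ∂(Q ρ D (t (φ n)))) Filter.atTop (nhds (∫ x, f x ∂P))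

/-- The statement of `stub_bulkLimitUnique`, as a `Prop`. -/
def BulkLimitUniqueStmt : Prop :=
  ∀ (Pois : MeasureTheory.Measure ℂ → MeasureTheory.Measure (Literature.Analysis.FunctionSpaces.PointConfig ℂ)), (∀ ν : MeasureTheory.Measure ℂ, MeasureTheory.IsLocallyFiniteMeasure ν → (∀ z : ℂ, ν {z} = 0) → Literature.Analysis.FunctionSpaces.IsPoissonPointProcess ν (Pois ν)) → let S : Literature.Analysis.FunctionSpaces.PointConfig ℂ → ℂ → Set ℂ := fun ω c => (ω : Set ℂ) ∩ Metric.sphere c (Metric.infDist c (ω : Set ℂ)); let vor : Literature.Analysis.FunctionSpaces.PointConfig ℂ → SimpleGraph ℂ := fun ω => SimpleGraph.fromRel fun c c' => 3 ≤ (S ω c).encard ∧ 3 ≤ (S ω c').encard ∧ (S ω c ∩ S ω c').encard = 2; let μ : ENNReal := essSup (fun ω => Filter.limsup (fun n : ℕ => (⨆ c : Metric.closedBall (0 : ℂ) 1, (Literature.Probability.RandomPlanarGeometry.SAW.sawCount (vor ω) (c : ℂ) n : ENNReal)) ^ (1 / (n : ℝ))) Filter.atTop) (Pois MeasureTheory.volume);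 let xc : ℝ := (μ.toReal)⁻¹; let near : Literature.Analysis.FunctionSpaces.PointConfig ℂ → Set ℂ → ℂ → ℂ := fun ω Ω z => Classical.epsilon fun v : ℂ => v ∈ Literature.Probability.RandomPlanarGeometry.SAW.embMeshDomain (vor ω) id Ω 1 ∧ ∀ w ∈ Literature.Probability.RandomPlanarGeometry.SAW.embMeshDomain (vor ω) id Ω 1, dist v z ≤ dist w z; let intens : (ℂ → ℝ) → ℝ → MeasureTheory.Measure ℂ := fun ρ δ => ENNReal.ofReal (δ⁻¹ ^ 2) • MeasureTheory.volume.withDensity fun z => ENNReal.ofReal (ρ z); let qlaw : Literature.Probability.RandomPlanarGeometry.DobrushinDomain → Literature.Analysis.FunctionSpaces.PointConfig ℂ → MeasureTheory.Measure (Literature.Probability.RandomPlanarGeometry.CurveClass ℂ) := fun D ω => (Literature.Probability.RandomPlanarGeometry.SAW.embLaw (vor ω) id D.carrier 1 xc (near ω D.carrier (D.pt 0)) (near ω D.carrier (D.pt 1))).map fun γ => γ.curve; let Q : (ℂ → ℝ) → Literature.Probability.RandomPlanarGeometry.DobrushinDomain → ℝ → MeasureTheory.Measure (Literature.Probability.RandomPlanarGeometry.CurveClass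 ℂ) := fun ρ D δ => (Pois (intens ρ δ)).bind (qlaw D); ∀ (D : Literature.Probability.RandomPlanarGeometry.DobrushinDomain) (ρ : ℂ → ℝ), ContDiffOn ℝ 2 ρ D.carrier → (∀ z ∈ D.carrier, 0 < ρ z) → (∀ z ∉ D.carrier, ρ z = 1) → MeasureTheory.IntegrableOn ρ D.carrier → ContDiff ℝ 2 ρ → tsupport (fun z => ρ z - 1) ⊆ D.carrier → ∀ t : ℕ → ℝ, Filter.Tendsto t Filter.atTop (nhdsWithin 0 (Set.Ioi 0)) → ∀ P P' : MeasureTheory.Measure (Literature.Probability.RandomPlanarGeometry.CurveClass ℂ), (∀ f : BoundedContinuousFunction (Literature.Probability.RandomPlanarGeometry.CurveClass ℂ) ℝ, Filter.Tendsto (fun n => ∫ x, f x ∂(Q ρ D (t n))) Filter.atTop (nhds (∫ x, f x ∂P))) → (∀ f : BoundedContinuousFunction (Literature.Probability.RandomPlanarGeometry.CurveClass ℂ) ℝ, Filter.Tendsto (fun n => ∫ x, f x ∂(Q (fun _ => 1) D (t n))) Filter.atTop (nhds (∫ x, f x ∂P'))) → ∀ f : BoundedContinuousFunction (Literature.Probability.RandomPlanarGeometry.CurveClass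 ℂ) ℝ, ∫ x, f x ∂P = ∫ x, f x ∂P'

/-- The statement of `stub_collarLimitStable`, as a `Prop`. -/
def CollarLimitStableStmt : Prop :=
  ∀ (Pois : MeasureTheory.Measure ℂ → MeasureTheory.Measure (Literature.Analysis.FunctionSpaces.PointConfig ℂ)), (∀ ν : MeasureTheory.Measure ℂ, MeasureTheory.IsLocallyFiniteMeasure ν → (∀ z : ℂ, ν {z} = 0) → Literature.Analysis.FunctionSpaces.IsPoissonPointProcess ν (Pois ν)) → let S : Literature.Analysis.FunctionSpaces.PointConfig ℂ → ℂ → Set ℂ := fun ω c => (ω : Set ℂ) ∩ Metric.sphere c (Metric.infDist c (ω : Set ℂ)); let vor : Literature.Analysis.FunctionSpaces.PointConfig ℂ → SimpleGraph ℂ := fun ω => SimpleGraph.fromRel fun c c' => 3 ≤ (S ω c).encard ∧ 3 ≤ (S ω c').encard ∧ (S ω c ∩ S ω c').encard = 2; let μ : ENNReal := essSup (fun ω => Filter.limsup (fun n : ℕ => (⨆ c : Metric.closedBall (0 : ℂ) 1, (Literature.Probability.RandomPlanarGeometry.SAW.sawCount (vor ω) (c : ℂ) n : ENNReal)) ^ (1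 / (n : ℝ))) Filter.atTop) (Pois MeasureTheory.volume); let xc : ℝ := (μ.toReal)⁻¹; let near : Literature.Analysis.FunctionSpaces.PointConfig ℂ → Set ℂ → ℂ → ℂ := fun ω Ω z => Classical.epsilon fun v : ℂ => v ∈ Literature.Probability.RandomPlanarGeometry.SAW.embMeshDomain (vor ω) id Ω 1 ∧ ∀ w ∈ Literature.Probability.RandomPlanarGeometry.SAW.embMeshDomain (vor ω) id Ω 1, dist v z ≤ dist w z; let intens : (ℂ → ℝ) → ℝ → MeasureTheory.Measure ℂ := fun ρ δ => ENNReal.ofReal (δ⁻¹ ^ 2) • MeasureTheory.volume.withDensity fun z => ENNReal.ofReal (ρ z); let qlaw : Literature.Probability.RandomPlanarGeometry.DobrushinDomain → Literature.Analysis.FunctionSpaces.PointConfig ℂ → MeasureTheory.Measure (Literature.Probability.RandomPlanarGeometry.CurveClass ℂ) := fun D ω => (Literature.Probability.RandomPlanarGeometry.SAW.embLaw (vor ω) id D.carrier 1 xc (near ω D.carrier (D.pt 0)) (near ω D.carrier (D.pt 1))).map fun γ => γ.curve; let Q : (ℂ → ℝ) → Literature.Probability.RandomPlanarGeometry.DobrushinDomain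 → ℝ → MeasureTheory.Measure (Literature.Probability.RandomPlanarGeometry.CurveClass ℂ) := fun ρ D δ => (Pois (intens ρ δ)).bind (qlaw D); ∀ (D : Literature.Probability.RandomPlanarGeometry.DobrushinDomain) (ρ : ℂ → ℝ), ContDiffOn ℝ 2 ρ D.carrier → (∀ z ∈ D.carrier, 0 < ρ z) → (∀ z ∉ D.carrier, ρ z = 1) → MeasureTheory.IntegrableOn ρ D.carrier → ∀ (f : BoundedContinuousFunction (Literature.Probability.RandomPlanarGeometry.CurveClass ℂ) ℝ) (η : ℝ), 0 < η → ∃ ε : ℝ, 0 < ε ∧ ∀ ρ' : ℂ → ℝ, ContDiffOn ℝ 2 ρ' D.carrier → (∀ z ∈ D.carrier, 0 < ρ' z) → (∀ z ∉ D.carrier, ρ' z = 1) → MeasureTheory.IntegrableOn ρ' D.carrier → Set.EqOn ρ' ρ {z | z ∈ D.carrier ∧ ε ≤ Metric.infDist z D.carrierᶜ} → ∀ t : ℕ → ℝ, Filter.Tendsto t Filter.atTop (nhdsWithin 0 (Set.Ioi 0)) → ∀ P P' : MeasureTheory.Measure (Literature.Probability.RandomPlanarGeometry.CurveClass ℂ),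 (∀ g : BoundedContinuousFunction (Literature.Probability.RandomPlanarGeometry.CurveClass ℂ) ℝ, Filter.Tendsto (fun n => ∫ x, g x ∂(Q ρ D (t n))) Filter.atTop (nhds (∫ x, g x ∂P))) → (∀ g : BoundedContinuousFunction (Literature.Probability.RandomPlanarGeometry.CurveClass ℂ) ℝ, Filter.Tendsto (fun n => ∫ x, g x ∂(Q ρ' D (t n))) Filter.atTop (nhds (∫ x, g x ∂P'))) → |(∫ x, f x ∂P) - ∫ x, f x ∂P'| < η

/-- The split child `DUBulk` (= `Lines/bulk_collar.lean : stub_duBulk`), as a `Prop`. -/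
def DUBulkStmt : Prop :=
  ∀ (Pois : MeasureTheory.Measure ℂ → MeasureTheory.Measure (Literature.Analysis.FunctionSpaces.PointConfig ℂ)), (∀ ν : MeasureTheory.Measure ℂ, MeasureTheory.IsLocallyFiniteMeasure ν → (∀ z : ℂ, ν {z} = 0) → Literature.Analysis.FunctionSpaces.IsPoissonPointProcess ν (Pois ν)) → let S : Literature.Analysis.FunctionSpaces.PointConfig ℂ → ℂ → Set ℂ := fun ω c => (ω : Set ℂ) ∩ Metric.sphere c (Metric.infDist c (ω : Set ℂ)); let vor : Literature.Analysis.FunctionSpaces.PointConfig ℂ → SimpleGraph ℂ := fun ω => SimpleGraph.fromRel fun c c' => 3 ≤ (S ω c).encard ∧ 3 ≤ (S ω c').encard ∧ (S ω c ∩ S ω c').encard = 2; let μ : ENNReal := essSup (fun ω => Filter.limsup (fun n : ℕ => (⨆ c : Metric.closedBall (0 : ℂ) 1, (Literature.Probability.RandomPlanarGeometry.SAW.sawCount (vor ω) (c : ℂ) n : ENNReal)) ^ (1 / (n : ℝ))) Filter.atTop) (Pois MeasureTheory.volume); let xc : ℝ := (μ.toReal)⁻¹; let near : Literature.Analysis.FunctionSpaces.PointConfig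 ℂ → Set ℂ → ℂ → ℂ := fun ω Ω z => Classical.epsilon fun v : ℂ => v ∈ Literature.Probability.RandomPlanarGeometry.SAW.embMeshDomain (vor ω) id Ω 1 ∧ ∀ w ∈ Literature.Probability.RandomPlanarGeometry.SAW.embMeshDomain (vor ω) id Ω 1, dist v z ≤ dist w z; let intens : (ℂ → ℝ) → ℝ → MeasureTheory.Measure ℂ := fun ρ δ => ENNReal.ofReal (δ⁻¹ ^ 2) • MeasureTheory.volume.withDensity fun z => ENNReal.ofReal (ρ z); let qlaw : Literature.Probability.RandomPlanarGeometry.DobrushinDomain → Literature.Analysis.FunctionSpaces.PointConfig ℂ → MeasureTheory.Measure (Literature.Probability.RandomPlanarGeometry.CurveClass ℂ) := fun D ω => (Literature.Probability.RandomPlanarGeometry.SAW.embLaw (vor ω) id D.carrier 1 xc (near ω D.carrier (D.pt 0)) (near ω D.carrier (D.pt 1))).map fun γ => γ.curve; let Q : (ℂ → ℝ) → Literature.Probability.RandomPlanarGeometry.DobrushinDomain → ℝ → MeasureTheory.Measure (Literature.Probability.RandomPlanarGeometry.CurveClass ℂ) := fun ρ D δ => (Pois (intens ρ δ)).bind (qlaw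 D); ∀ (D : Literature.Probability.RandomPlanarGeometry.DobrushinDomain) (ρ : ℂ → ℝ), ContDiffOn ℝ 2 ρ D.carrier → (∀ z ∈ D.carrier, 0 < ρ z) → (∀ z ∉ D.carrier, ρ z = 1) → MeasureTheory.IntegrableOn ρ D.carrier → ContDiff ℝ 2 ρ → tsupport (fun z => ρ z - 1) ⊆ D.carrier → ∀ f : BoundedContinuousFunction (Literature.Probability.RandomPlanarGeometry.CurveClass ℂ) ℝ, Filter.Tendsto (fun δ => (∫ x, f x ∂(Q ρ D δ)) - ∫ x, f x ∂(Q (fun _ => 1) D δ)) (nhdsWithin 0 (Set.Ioi 0)) (nhds 0)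

/-- The split child `DUCollar` (= `Lines/bulk_collar.lean : stub_duCollar`), as a `Prop`. -/
def DUCollarStmt : Prop :=
  ∀ (Pois : MeasureTheory.Measure ℂ → MeasureTheory.Measure (Literature.Analysis.FunctionSpaces.PointConfig ℂ)), (∀ ν : MeasureTheory.Measure ℂ, MeasureTheory.IsLocallyFiniteMeasure ν → (∀ z : ℂ, ν {z} = 0) → Literature.Analysis.FunctionSpaces.IsPoissonPointProcess ν (Pois ν)) → let S : Literature.Analysis.FunctionSpaces.PointConfig ℂ → ℂ → Set ℂ := fun ω c => (ω : Set ℂ) ∩ Metric.sphere c (Metric.infDist c (ω : Set ℂ)); let vor : Literature.Analysis.FunctionSpaces.PointConfig ℂ → SimpleGraph ℂ := fun ω => SimpleGraph.fromRel fun c c' => 3 ≤ (S ω c).encard ∧ 3 ≤ (S ω c').encard ∧ (S ω c ∩ S ω c').encard = 2; let μ : ENNReal := essSup (fun ω => Filter.limsup (fun n : ℕ => (⨆ c : Metric.closedBall (0 : ℂ) 1, (Literature.Probability.RandomPlanarGeometry.SAW.sawCount (vor ω) (c : ℂ) n : ENNReal)) ^ (1 / (n : ℝ))) Filter.atTop)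 (Pois MeasureTheory.volume); let xc : ℝ := (μ.toReal)⁻¹; let near : Literature.Analysis.FunctionSpaces.PointConfig ℂ → Set ℂ → ℂ → ℂ := fun ω Ω z => Classical.epsilon fun v : ℂ => v ∈ Literature.Probability.RandomPlanarGeometry.SAW.embMeshDomain (vor ω) id Ω 1 ∧ ∀ w ∈ Literature.Probability.RandomPlanarGeometry.SAW.embMeshDomain (vor ω) id Ω 1, dist v z ≤ dist w z; let intens : (ℂ → ℝ) → ℝ → MeasureTheory.Measure ℂ := fun ρ δ => ENNReal.ofReal (δ⁻¹ ^ 2) • MeasureTheory.volume.withDensity fun z => ENNReal.ofReal (ρ z); let qlaw : Literature.Probability.RandomPlanarGeometry.DobrushinDomain → Literature.Analysis.FunctionSpaces.PointConfig ℂ → MeasureTheory.Measure (Literature.Probability.RandomPlanarGeometry.CurveClass ℂ) := fun D ω => (Literature.Probability.RandomPlanarGeometry.SAW.embLaw (vor ω) id D.carrier 1 xc (near ω D.carrier (D.pt 0)) (near ω D.carrier (D.pt 1))).map fun γ => γ.curve; let Q : (ℂ → ℝ) → Literature.Probability.RandomPlanarGeometry.DobrushinDomain → ℝ → MeasureTheory.Measure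 (Literature.Probability.RandomPlanarGeometry.CurveClass ℂ) := fun ρ D δ => (Pois (intens ρ δ)).bind (qlaw D); ∀ (D : Literature.Probability.RandomPlanarGeometry.DobrushinDomain) (ρ : ℂ → ℝ), ContDiffOn ℝ 2 ρ D.carrier → (∀ z ∈ D.carrier, 0 < ρ z) → (∀ z ∉ D.carrier, ρ z = 1) → MeasureTheory.IntegrableOn ρ D.carrier → ∀ (f : BoundedContinuousFunction (Literature.Probability.RandomPlanarGeometry.CurveClass ℂ) ℝ) (η : ℝ), 0 < η → ∃ ε : ℝ, 0 < ε ∧ ∀ ρ' : ℂ → ℝ, ContDiffOn ℝ 2 ρ' D.carrier → (∀ z ∈ D.carrier, 0 < ρ' z) → (∀ z ∉ D.carrier, ρ' z = 1) → MeasureTheory.IntegrableOn ρ' D.carrier → Set.EqOn ρ' ρ {z | z ∈ D.carrier ∧ ε ≤ Metric.infDist z D.carrierᶜ} → ∀ᶠ δ in nhdsWithin 0 (Set.Ioi 0), |(∫ x, f x ∂(Q ρ D δ)) - ∫ x, f x ∂(Q ρ' D δ)| ≤ η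

theorem admPrecompactStmt_holds : AdmPrecompactStmt := stub_admPrecompact
theorem bulkLimitUniqueStmt_holds : BulkLimitUniqueStmt := stub_bulkLimitUnique
theorem collarLimitStableStmt_holds : CollarLimitStableStmt := stub_collarLimitStable

namespace __Registered

/-- Alias of `AdmPrecompactStmt` keyed by the registered stub name. -/
abbrev stub_admPrecompact : Prop := AdmPrecompactStmt
/-- Alias of `BulkLimitUniqueStmt` keyed by the registered stub name. -/
abbrev stub_bulkLimitUnique : Prop := BulkLimitUniqueStmt
/-- Alias of `CollarLimitStableStmt` keyed by the registered stub name. -/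
abbrev stub_collarLimitStable : Prop := CollarLimitStableStmt

end __Registered

/-! ### Child 1 from stubs 1 + 2 -/

/-- **`DUBulk` from precompactness + bulk identification** (subsequence-of-subsequence criterion
along the countably generated filter `𝓝[>] 0`). [folklore] -/
theorem duBulk_of (hP : AdmPrecompactStmt) (hU : BulkLimitUniqueStmt) : DUBulkStmt := by
  intro Pois hPois
  have hP' := hP Pois hPois
  have hU' := hU Pois hPois
  clear hP hU
  intro S vor μ xc near intens qlaw Q D ρ hρ hpos hout hint hC2 hsupp f
  refine Filter.tendsto_of_subseq_tendsto fun ns hns => ?_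
  obtain ⟨φ₁, hφ₁, P, -, hlimP⟩ := hP' D ρ hρ hpos hout hint ns hns
  have hns₁ : Filter.Tendsto (fun n => ns (φ₁ n)) Filter.atTop (nhdsWithin 0 (Set.Ioi 0)) :=
    hns.comp hφ₁.tendsto_atTop
  have h1D : MeasureTheory.IntegrableOn (fun _ : ℂ => (1 : ℝ)) D.carrier := by
    rw [MeasureTheory.integrableOn_const_iff]
    exact Or.inr D.isBounded.measure_lt_top
  obtain ⟨φ₂, hφ₂, P', -, hlimP'⟩ := hP' D (fun _ => 1) contDiffOn_const (fun z _ => one_pos)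
    (fun z _ => rfl) h1D (fun n => ns (φ₁ n)) hns₁
  have heq : ∫ x, f x ∂P = ∫ x, f x ∂P' :=
    hU' D ρ hρ hpos hout hint hC2 hsupp (fun n => ns (φ₁ (φ₂ n))) (hns₁.comp hφ₂.tendsto_atTop) P P'
      (fun g => (hlimP g).comp hφ₂.tendsto_atTop) (fun g => hlimP' g) f
  refine ⟨fun n => φ₁ (φ₂ n), ?_⟩
  have h1 : Filter.Tendsto (fun n => ∫ x, f x ∂(Q ρ D (ns (φ₁ (φ₂ n))))) Filter.atTop
      (nhds (∫ x, f x ∂P)) := (hlimP f).comp hφ₂.tendsto_atTop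
  have h2 : Filter.Tendsto (fun n => ∫ x, f x ∂(Q (fun _ => 1) D (ns (φ₁ (φ₂ n))))) Filter.atTop
      (nhds (∫ x, f x ∂P')) := hlimP' f
  have h12 := h1.sub h2
  rw [heq, sub_self] at h12
  exact h12

/-! ### Child 2 from stubs 1 + 3 -/

/-- **`DUCollar` from precompactness + collar stability of limits** (by contradiction: a sequence
`t n → 0+` on which the difference stays `> η`, two extractions, and the limit inequality). [folklore] -/
theorem duCollar_of (hP : AdmPrecompactStmt) (hS : CollarLimitStableStmt) : DUCollarStmt := by
  intro Pois hPois
  have hP' := hP Pois hPois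
  have hS' := hS Pois hPois
  clear hP hS
  intro S vor μ xc near intens qlaw Q D ρ hρ hpos hout hint f η hη
  obtain ⟨ε, hε, hst⟩ := hS' D ρ hρ hpos hout hint f η hη
  refine ⟨ε, hε, fun ρ' hρ' hpos' hout' hint' heq => ?_⟩
  by_contra hnot
  obtain ⟨ns, hns, hbad⟩ := Filter.exists_seq_forall_of_frequently (Filter.not_eventually.1 hnot)
  obtain ⟨φ₁, hφ₁, P, -, hlimP⟩ := hP' D ρ hρ hpos hout hint ns hns
  have hns₁ : Filter.Tendsto (fun n => ns (φ₁ n)) Filter.atTop (nhdsWithin 0 (Set.Ioi 0)) :=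
    hns.comp hφ₁.tendsto_atTop
  obtain ⟨φ₂, hφ₂, P', -, hlimP'⟩ := hP' D ρ' hρ' hpos' hout' hint' (fun n => ns (φ₁ n)) hns₁
  have hlt : |(∫ x, f x ∂P) - ∫ x, f x ∂P'| < η :=
    hst ρ' hρ' hpos' hout' hint' heq (fun n => ns (φ₁ (φ₂ n))) (hns₁.comp hφ₂.tendsto_atTop) P P'
      (fun g => (hlimP g).comp hφ₂.tendsto_atTop) (fun g => hlimP' g)
  have hconv : Filter.Tendsto
      (fun n => |(∫ x, f x ∂(Q ρ D (ns (φ₁ (φ₂ n))))) - ∫ x, f x ∂(Q ρ' D (ns (φ₁ (φ₂ n))))|)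
      Filter.atTop (nhds |(∫ x, f x ∂P) - ∫ x, f x ∂P'|) :=
    (((hlimP f).comp hφ₂.tendsto_atTop).sub (hlimP' f)).abs
  have hge : ∀ n, η ≤ |(∫ x, f x ∂(Q ρ D (ns (φ₁ (φ₂ n))))) - ∫ x, f x ∂(Q ρ' D (ns (φ₁ (φ₂ n))))| :=
    fun n => le_of_lt (not_le.1 (hbad (φ₁ (φ₂ n))))
  have hle : η ≤ |(∫ x, f x ∂P) - ∫ x, f x ∂P'| := ge_of_tendsto' hconv hge
  linarith

/-! ### The bulk / collar glue (as in `Lines/bulk_collar.lean`) -/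

/-- Smooth Urysohn lemma on `ℂ` (Mathlib's `exists_contMDiffMap_zero_one_of_isClosed` on `ℂ`
regarded as a manifold modelled on itself). [folklore] -/
theorem exists_contDiff_zero_one {s t : Set ℂ} (hs : IsClosed s) (ht : IsClosed t)
    (hd : Disjoint s t) :
    ∃ χ : ℂ → ℝ, ContDiff ℝ 2 χ ∧ (∀ x ∈ s, χ x = 0) ∧ (∀ x ∈ t, χ x = 1) ∧
      ∀ x, χ x ∈ Icc (0 : ℝ) 1 := by
  obtain ⟨f, hf0, hf1, hf⟩ := exists_contMDiffMap_zero_one_of_isClosed (I := modelWithCornersSelf ℝ ℂ) (M := ℂ)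
    (n := (2 : ℕ∞)) hs ht hd
  refine ⟨f, ?_, fun x hx => hf0 hx, fun x hx => hf1 hx, hf⟩
  have h := f.contMDiff.contDiff
  exact_mod_cast h

/-- Triangle-inequality bookkeeping: if `a - b` is eventually at most `η/2` in absolute value and
`b - c → 0`, then eventually `|a - c| < η`. [folklore] -/
theorem eventually_dist_lt_of_abs_sub_le_of_tendsto {l : Filter ℝ} {a b c : ℝ → ℝ} {η : ℝ}
    (hη : 0 < η) (h1 : ∀ᶠ δ in l, |a δ - b δ| ≤ η / 2)
    (h2 : Tendsto (fun δ => b δ - c δ) l (nhds 0)) :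
    ∀ᶠ δ in l, dist (a δ - c δ) 0 < η := by
  have h2' := (Metric.tendsto_nhds.1 h2) (η / 2) (half_pos hη)
  filter_upwards [h1, h2'] with δ hδ1 hδ2
  rw [Real.dist_0_eq_abs] at hδ2 ⊢
  calc |a δ - c δ| = |(a δ - b δ) + (b δ - c δ)| := by ring_nf
    _ ≤ |a δ - b δ| + |b δ - c δ| := abs_add_le _ _
    _ < η := by linarith

/-- **Collar cutoff.** A density `ρ` that is `C²` and positive on the (open, bounded) carrier of a
Dobrushin domain agrees, on the closed inner region `{z ∈ D | ε ≤ dist(z, Dᶜ)}`, with a density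
`ρ'` that is `C²` on all of `ℂ`, positive on `D`, identically `1` off `D` and near `∂D`
(`tsupport (ρ' - 1) ⊆ D`) and integrable on `D`: `ρ' = 1 + χ (ρ - 1)` for a smooth Urysohn
function `χ` equal to `1` on the inner region and to `0` on `{dist(·, Dᶜ) ≤ ε/2}`. [folklore] -/
theorem exists_collar_cutoff (D : Literature.Probability.RandomPlanarGeometry.DobrushinDomain)
    (ρ : ℂ → ℝ) (hρ : ContDiffOn ℝ 2 ρ D.carrier) (hpos : ∀ z ∈ D.carrier, 0 < ρ z)
    {ε : ℝ} (hε : 0 < ε) :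
    ∃ ρ' : ℂ → ℝ, ContDiff ℝ 2 ρ' ∧ tsupport (fun z => ρ' z - 1) ⊆ D.carrier ∧
      (∀ z ∈ D.carrier, 0 < ρ' z) ∧ (∀ z ∉ D.carrier, ρ' z = 1) ∧
      MeasureTheory.IntegrableOn ρ' D.carrier ∧
      Set.EqOn ρ' ρ {z | z ∈ D.carrier ∧ ε ≤ Metric.infDist z D.carrierᶜ} := by
  have hcont : Continuous fun z : ℂ => Metric.infDist z D.carrierᶜ :=
    Metric.continuous_infDist_pt _
  have hS : IsClosed {z : ℂ | Metric.infDist z D.carrierᶜ ≤ ε / 2} :=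
    isClosed_le hcont continuous_const
  have hT : IsClosed {z : ℂ | ε ≤ Metric.infDist z D.carrierᶜ} :=
    isClosed_le continuous_const hcont
  have hST : Disjoint {z : ℂ | Metric.infDist z D.carrierᶜ ≤ ε / 2}
      {z : ℂ | ε ≤ Metric.infDist z D.carrierᶜ} := by
    refine Set.disjoint_left.2 fun z h1 h2 => ?_
    simp only [Set.mem_setOf_eq] at h1 h2
    linarith
  obtain ⟨χ, hχs, hχ0, hχ1, hχ01⟩ := exists_contDiff_zero_one hS hT hST
  -- a point at positive distance from `Dᶜ` lies in `D`
  have memD : ∀ z : ℂ, 0 < Metric.infDist z D.carrierᶜ → z ∈ D.carrier := fun z hz => by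
    by_contra h
    exact (ne_of_gt hz) (Metric.infDist_zero_of_mem (show z ∈ D.carrierᶜ from h))
  -- off `D` the cutoff vanishes
  have hχD : ∀ z, z ∉ D.carrier → χ z = 0 := fun z hz => by
    apply hχ0
    simp only [Set.mem_setOf_eq, Metric.infDist_zero_of_mem (show z ∈ D.carrierᶜ from hz)]
    linarith
  set ρ' : ℂ → ℝ := fun z => 1 + χ z * (ρ z - 1) with hρ'
  have hC2 : ContDiff ℝ 2 ρ' := by
    rw [contDiff_iff_contDiffAt]
    intro z
    by_cases hz : z ∈ D.carrier
    · exact contDiffAt_const.add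
        (hχs.contDiffAt.mul ((hρ.contDiffAt (D.isOpen.mem_nhds hz)).sub contDiffAt_const))
    · have hU : {w : ℂ | Metric.infDist w D.carrierᶜ < ε / 2} ∈ 𝓝 z := by
        refine (isOpen_lt hcont continuous_const).mem_nhds ?_
        simp only [Set.mem_setOf_eq, Metric.infDist_zero_of_mem (show z ∈ D.carrierᶜ from hz)]
        linarith
      refine (contDiffAt_const (c := (1 : ℝ))).congr_of_eventuallyEq ?_
      filter_upwards [hU] with w hw
      have : χ w = 0 := hχ0 w (le_of_lt hw)
      simp [hρ', this]
  refine ⟨ρ', hC2, ?_, ?_, ?_, ?_, ?_⟩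
  · -- tsupport (ρ' - 1) ⊆ {ε/2 ≤ infDist} ⊆ D
    intro z hz
    apply memD
    have hsub : tsupport (fun z => ρ' z - 1) ⊆ {z : ℂ | ε / 2 ≤ Metric.infDist z D.carrierᶜ} := by
      refine closure_minimal ?_ (isClosed_le continuous_const hcont)
      intro w hw
      rw [Function.mem_support] at hw
      by_contra hlt
      simp only [Set.mem_setOf_eq, not_le] at hlt
      exact hw (by simp [hρ', hχ0 w (le_of_lt hlt)])
    have := hsub hz
    simp only [Set.mem_setOf_eq] at this
    linarith
  · -- positivity on D: ρ' = (1 - χ) + χ ρ ≥ min 1 ρ > 0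
    intro z hz
    have h0 : 0 ≤ χ z := (hχ01 z).1
    have h1 : χ z ≤ 1 := (hχ01 z).2
    have hρz : 0 < ρ z := hpos z hz
    have hm : 0 < min 1 (ρ z) := lt_min one_pos hρz
    simp only [hρ']
    nlinarith [min_le_left 1 (ρ z), min_le_right 1 (ρ z),
      mul_nonneg h0 (sub_nonneg.2 (min_le_right 1 (ρ z))),
      mul_nonneg (sub_nonneg.2 h1) (sub_nonneg.2 (min_le_left 1 (ρ z)))]
  · -- ρ' = 1 off D
    intro z hz
    simp [hρ', hχD z hz]
  · -- integrable on the bounded set D (continuous on its compact closure)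
    exact (hC2.continuous.continuousOn.integrableOn_compact
      D.isBounded.isCompact_closure).mono_set subset_closure
  · -- agreement on the inner region
    intro z hz
    have : χ z = 1 := hχ1 z hz.2
    simp [hρ', this]


theorem densityUniversality_of_bulk_collar (hB : DUBulkStmt) (hC : DUCollarStmt) :
    Summit.CriticalPhenomena.SAWScalingLimit.Theses.SAWPoissonHoneycomb.DensityUniversality := by
  intro Pois hPois
  have hB' := hB Pois hPois
  have hC' := hC Pois hPois
  clear hB hC
  intro S vor μ xc near intens qlaw Q D ρ hρ hpos hout hint f
  rw [Metric.tendsto_nhds]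
  intro η hη
  obtain ⟨ε, hε, hstab⟩ := hC' D ρ hρ hpos hout hint f (η / 2) (half_pos hη)
  obtain ⟨ρ', hC2, hsupp, hpos', hout', hint', heq⟩ := exists_collar_cutoff D ρ hρ hpos hε
  have h1 := hstab ρ' hC2.contDiffOn hpos' hout' hint' heq
  have h2 := hB' D ρ' hC2.contDiffOn hpos' hout' hint' hC2 hsupp f
  exact eventually_dist_lt_of_abs_sub_le_of_tendsto hη h1 h2



/-! ### The skeleton theorem: the three stubs imply the crux, BY NAME -/

/-- **`DensityUniversality` from the line `subseq-identification`** — precompactness + bulk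
identification give `DUBulk` (`duBulk_of`), precompactness + collar stability give `DUCollar`
(`duCollar_of`), and the bulk/collar glue concludes the crux decl by name. [folklore] -/
theorem DensityUniversality_of (hP : __Registered.stub_admPrecompact)
    (hU : __Registered.stub_bulkLimitUnique) (hS : __Registered.stub_collarLimitStable) :
    Summit.CriticalPhenomena.SAWScalingLimit.Theses.SAWPoissonHoneycomb.DensityUniversality :=
  densityUniversality_of_bulk_collar (duBulk_of hP hU) (duCollar_of hP hS)

end Summit.CriticalPhenomena.SAWScalingLimit.Cruxes.DensityUniversality.SubseqIdentification
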